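import Summits.BirchSwinnertonDyer.BirchSwinnertonDyer.Theorems.ByReductionTypeAtTwoRankOneAtTwoOffBigImageOddLocalEngineRegularSupply
import Literature.NumberTheory.GaloisRepresentations.ImaginaryQuadraticCyclotomicProofs
import Literature.NumberTheory.GaloisRepresentations.ArtinFormalismInductionProofs
import HarnessLib

/-!
# Route `ByReductionTypeAtTwo`, crux `RankOneAtTwoOffBigImageOddLocal` (stmt-BirchSwinnertonDyer-23716), line
# `refined_kolyvagin_tamagawa_shift_at_two` — ENGINE PORT `c₀ ↦ h₀`, step E1c: the ARITHMETIC dichotomy «regular lift OR parity character»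

Lead prover `prover-cruxlead-stmt-BirchSwinnertonDyer-23716-g0` (2026-08-28).  Card «ENGINE-PORT MAP (g6)» step E1 (REGULAR SUPPLY) at `Δ > 0`, the
arithmetic instantiation of the landed group-level dichotomy `Engine.regular_lift_dichotomy` (`…EngineGoursatLift.lean`) with
`G = Γ_ℚ`, `φ` = the framed representation on `E[2^{M+1}]` (onto when `ρ̄_{E,2^{M+1}}` is: `Engine.framedRep_surjective`), `χ = χ_K` = the sign
character of the index-`2` subgroup `Γ_K = res(Γ_K) ≤ Γ_ℚ` (`index_range_absGaloisRestrict_eq_finrank`), `g₀ = c₀` (complex conjugation: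
`χ_K(c₀) = −1` because `K` is totally complex, `det ρ(c₀) = χ_cyc(c₀) = −1`):

* `Engine.regular_lift_or_exceptional` — EITHER some `g ∈ Γ_ℚ` acts on `E[2^{M+1}]` by the regular involution `Engine.regR M` and on the embedded
  `K` like `c₀` (then `Engine.regularSupply_of_regular_lift` packages it for the landed Steps C–H
  `Engine.exists_kolyvaginPrime_gt_two_of_galoisElement_regular`), OR `Γ_K` is cut out by a PARITY character: for some character `ε` of
  `(ℤ/2^{M+1})ˣ`, `g ∈ Γ_K ⟺ sgn(ρ(g) mod 2)·ε(det ρ(g)) = 1` — the exceptional branch, which the card closes on the regular cells (`sgn ∘ red₂ ∘ ρ̄`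
  cuts out `ℚ(√Δ)`, `ε ∘ χ_cyc` one of `ℚ, ℚ(i), ℚ(√±2)`, so `K ∈ {ℚ(√±Δ), ℚ(√±2Δ)}`, excluded by `Δ > 0`, `K` imaginary and the crux-side binders
  `¬ IsSquare (d_K·(−|Δ|))`, `¬ IsSquare (d_K·(−2|Δ|))`; that closure is NOT in this file).

NEW Lean by the lead (not in the quarry).  Nothing here proves the crux, `BSDp W 2`, BSD or the summit; no registered stub is discharged.  BSD is not proved.

Refs: [GrossLMS1991] §3; [McCallumLMS1991] §3; Serre (1972) §5.3; Silverman in Cornell–Silverman–Stevens Ch. II §§7–8 (`det ρ̄ = χ_cyc`).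
-/

set_option linter.dupNamespace false -- tree convention: `Summit.BirchSwinnertonDyer.BirchSwinnertonDyer.Theorems` (summit = sub-problem)
set_option autoImplicit false

noncomputable section

namespace Summit.BirchSwinnertonDyer.BirchSwinnertonDyer.Theorems.OffBigImageOddLocalAtTwo.Engine

open scoped Classical MatrixGroups
open WeierstrassCurve Field Matrix NumberField
open Literature Literature.NumberTheory.GaloisRepresentations Literature.NumberTheory.EllipticCurves

/-- **E1c, ARITHMETIC DICHOTOMY.**  `K` imaginary quadratic, `c₀` a complex conjugation, `e` a frame of `E[2^{M+1}]` with framed representation `ρ`,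
`ρ̄_{E,2^{M+1}}` onto.  EITHER a regular lift exists — `g ∈ Γ_ℚ` with `ρ g = regR M` acting on the embedded `K` like `c₀` — OR the subgroup
`Γ_K ≤ Γ_ℚ` is cut out by a parity character: `g ∈ Γ_K ⟺ sgn(ρ g mod 2) · ε(det ρ g) = 1` for some character `ε` of `(ℤ/2^{M+1})ˣ`.
Instance of `Engine.regular_lift_dichotomy` (φ = `ρ`, onto by `framedRep_surjective`; χ = the sign character of the index-`2` subgroup `res(Γ_K)`;
g₀ = `c₀`, with `χ(c₀) = −1` by `Rat.not_mem_range_absGaloisRestrict_of_isComplexConjugation` and `det ρ c₀ = χ_cyc(c₀) = −1` by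
`det_eq_modNCyclotomicCharacter` + `modNCyclotomicCharacter_of_isComplexConjugation`). [cite: Serre1972, §5.3] -/
theorem regular_lift_or_exceptional (W : WeierstrassCurve ℚ) [W.IsElliptic]
    (K : Type) [Field K] [NumberField K] (hK : IsImaginaryQuadratic K) (M : ℕ)
    (e : geomTorsion W ((2 ^ (M + 1) : ℕ) : ℤ) ≃+ (Fin 2 → ZMod (2 ^ (M + 1))))
    (ρ : absoluteGaloisGroup ℚ →* GL (Fin 2) (ZMod (2 ^ (M + 1))))
    (hρ : ∀ (σ : absoluteGaloisGroup ℚ) (P : geomTorsion W ((2 ^ (M + 1) : ℕ) : ℤ)),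
      e (σ • P) = ((ρ σ : GL (Fin 2) (ZMod (2 ^ (M + 1)))) : Matrix (Fin 2) (Fin 2) (ZMod (2 ^ (M + 1)))) *ᵥ e P)
    (hsurj : W.HasSurjectiveModNGaloisRep ((2 ^ (M + 1) : ℕ) : ℤ))
    {c₀ : absoluteGaloisGroup ℚ} (hc₀ : IsComplexConjugation (Rat.castHom ℝ) c₀) :
    (∃ g : absoluteGaloisGroup ℚ, ρ g = regR M ∧ ∀ x : K, g • absEmbedding ℚ K x = c₀ • absEmbedding ℚ K x) ∨
    (∃ ε : (ZMod (2 ^ (M + 1)))ˣ →* ℤˣ, ∀ g : absoluteGaloisGroup ℚ,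
        g ∈ ((absGaloisRestrict ℚ K).range : Subgroup (absoluteGaloisGroup ℚ)) ↔
          (if OddModTwoGL (ρ g) then (-1 : ℤˣ) else 1) * ε (Matrix.GeneralLinearGroup.det (ρ g)) = 1) := by
  haveI : NeZero (2 ^ (M + 1)) := ⟨pow_ne_zero _ two_ne_zero⟩
  haveI : NeZero ((2 ^ (M + 1) : ℕ) : ℚ) := ⟨by exact_mod_cast pow_ne_zero (M + 1) two_ne_zero⟩
  haveI : IsTotallyComplex K := hK.2
  -- the index-2 subgroup `Γ_K ≤ Γ_ℚ` and its sign character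
  set H : Subgroup (absoluteGaloisGroup ℚ) := (absGaloisRestrict ℚ K).range with hH
  have hidx : H.index = 2 := by
    rw [hH, index_range_absGaloisRestrict_eq_finrank ℚ K, hK.1]
  let χ : absoluteGaloisGroup ℚ →* ℤˣ :=
    { toFun := fun g ↦ if g ∈ H then 1 else -1
      map_one' := by rw [if_pos H.one_mem]
      map_mul' := fun a b ↦ by
        have hab := Subgroup.mul_mem_iff_of_index_two hidx (a := a) (b := b)
        by_cases ha : a ∈ H <;> by_cases hb : b ∈ H
        · rw [if_pos (hab.mpr (iff_of_true ha hb)), if_pos ha, if_pos hb, one_mul]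
        · rw [if_neg (fun h ↦ hb ((hab.mp h).mp ha)), if_pos ha, if_neg hb, one_mul]
        · rw [if_neg (fun h ↦ ha ((hab.mp h).mpr hb)), if_neg ha, if_pos hb, mul_one]
        · rw [if_pos (hab.mpr (iff_of_false ha hb)), if_neg ha, if_neg hb]
          simp }
  have hχ : ∀ g, χ g = if g ∈ H then 1 else -1 := fun g ↦ rfl
  have hA : ∀ a : ℤˣ, a = 1 ∨ a = -1 := Int.units_eq_one_or
  have hc₀H : c₀ ∉ H := Rat.not_mem_range_absGaloisRestrict_of_isComplexConjugation K hK.2 hc₀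
  have hχc₀ : χ c₀ = -1 := by rw [hχ, if_neg hc₀H]
  have hφ : Function.Surjective ρ := framedRep_surjective W e ρ hρ hsurj
  -- `det ρ c₀ = χ_cyc(c₀) = -1`
  have hdet : Matrix.GeneralLinearGroup.det (ρ c₀) = -1 := by
    have h := det_eq_modNCyclotomicCharacter W (2 ^ (M + 1)) (by
        calc 2 ≤ 2 ^ 1 := by norm_num
          _ ≤ 2 ^ (M + 1) := Nat.pow_le_pow_right (by norm_num) (by omega)) e c₀
      ((ρ c₀ : GL (Fin 2) (ZMod (2 ^ (M + 1)))) : Matrix (Fin 2) (Fin 2) (ZMod (2 ^ (M + 1)))) (hρ c₀)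
    rw [modNCyclotomicCharacter_of_isComplexConjugation (K := ℚ) (N := 2 ^ (M + 1)) hc₀] at h
    apply Units.ext
    rw [Matrix.GeneralLinearGroup.val_det_apply, h, Units.val_neg, Units.val_one]
  rcases regular_lift_dichotomy ρ hφ χ hA (g₀ := c₀) hχc₀ with hlift | ⟨-, ε, hε⟩
  · -- regular branch
    left
    obtain ⟨g, hg, hχg⟩ := exists_regular_lift ρ χ hdet hlift
    refine ⟨g, hg, fun x ↦ ?_⟩
    have hgH : g ∉ H := by
      intro h; rw [hχ, if_pos h] at hχg; exact absurd hχg (by decide)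
    have hmem : c₀⁻¹ * g ∈ H :=
      (Subgroup.mul_mem_iff_of_index_two hidx).mpr (iff_of_false (fun h ↦ hc₀H (H.inv_mem_iff.mp h)) hgH)
    have hfix := (mem_range_absGaloisRestrict_iff_smul_absEmbedding ℚ K (c₀⁻¹ * g)).mp hmem x
    rw [mul_smul, inv_smul_eq_iff] at hfix
    exact hfix
  · -- exceptional branch
    right
    refine ⟨ε, fun g ↦ ?_⟩
    have h := hε g
    constructor
    · intro hg
      rw [hχ, if_pos hg] at h
      exact h.symm
    · intro h1
      by_contra hg
      rw [hχ, if_neg hg, h1] at h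
      exact absurd h (by decide)

end Summit.BirchSwinnertonDyer.BirchSwinnertonDyer.Theorems.OffBigImageOddLocalAtTwo.Engine

end
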